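import Summits.AtomisticToContinuum.HydrodynamicLimit.Theorems.AntiMazurCoboundariesKineticWindowGronwallFrameUniv
import Summits.AtomisticToContinuum.HydrodynamicLimit.Theorems.TwoClocksEquilibriumShearWindowLDStatic
import Summits.AtomisticToContinuum.HydrodynamicLimit.Theorems.AntiMazurCoboundariesKineticWindowGronwallQuadraticMoment
import Summits.AtomisticToContinuum.HydrodynamicLimit.Theorems.OneFlightGossipEngineKineticCurrentsWindowLDApriori
import Literature.MathematicalPhysics.KineticTheory.HardSphereWindowPressureStatic
import HarnessLib

/-!
# Equilibrium family node from the pointwise kinetic node, layer 1: frame reduction and Gaussian tail statics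

Crux `Summit.AtomisticToContinuum.HydrodynamicLimit.Theses.TwoClocks.TransferEntropyClock` (stmt-AtomisticToContinuum-16625),
line `Sketch`, registered stub S3a `stub_equilibriumFamily : EquilibriumFamilyUpgrade`
(`= WindowUpgrade → TwoClocks.KineticWindowLDUniform → EquilibriumKineticLDFamily`): THE POINTWISE KINETIC DOCKING NODE IS
SECRETLY FAMILY-UNIFORM AT GLOBAL EQUILIBRIUM — along one-parameter families of CONSTANT profiles `(a(s), θ(s), u(s))` and
x-independent weights at one fixed reduced density `σ`, the window-LD bound holds with a tilt radius `β₀` and, per `(β, ε)`,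
thresholds `τ₀, N₀` UNIFORM in the family parameter. Proof files (lead prover-line-stmt-AtomisticToContinuum-16625-0):
`…EquilibriumFamilyFrame` (this chain's layer 1: exact frame reduction + Gaussian tail statics), `…EquilibriumFamilyStatics`
(layer 2: the property `Good`, midpoint convexity, closed radius super-level sets), `…EquilibriumFamilyBaire` (layer 3: the Banach
space of admissible profiles, the Baire uniform-radius theorem, orthogonality transfer), `…EquilibriumFamily` (layer 4: the stub).

THIS FILE. (1) For an x-INDEPENDENT continuous velocity observable `φ` the window exponential moment
`vMoment σ a θ u N Φ φ β τ = ∫⁻ exp(β Σᵢ w⁻¹∫₀ʷ φ(vᵢ(r)) dr) dG_N(a, u, θ)` in the frame `(a, θ, u)` EQUALS the unit-frame moment of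
`v ↦ φ(√θ v)` at window `√θ τ` for the SAME flow family (`vMoment_frame`): activity is a dummy, the velocity translation of the
datum and the Galilean boost of the canonical flow remove the drift exactly (positions are not seen), the thermal scaling of
velocities and time removes `θ`, and every hard-sphere flow agrees with the canonical (Alexander) flow a.e. forward in time — all
the landed frame-covariance toolkit of route AntiMazurCoboundaries. (2) The Gaussian tail statics of the compactness step:
`∫ e^{K(1+‖v‖²)} dN(0,1) ≤ e^{13K}` (`K ≤ 1/8`), the tail beyond a radius is eventually small (`exists_tail_le`), and the static
window bound `vMoment_le_of_abs_le_tail` for an observable that is `δ(1+‖v‖²)`-small on `‖v‖ ≤ L` and `K(1+‖v‖²)`-bounded beyond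
(Jensen in time + invariance, one-site Gaussian factorisation).
-/

noncomputable section

open MeasureTheory Filter Set Topology Function
open scoped ENNReal
open Literature.MathematicalPhysics.KineticTheory Literature.Analysis.FluidPDE
open Summit.AtomisticToContinuum.HydrodynamicLimit.Theorems.KineticWindowGronwallBoost
open Summit.AtomisticToContinuum.HydrodynamicLimit.Theorems.KineticWindowGronwallThermalScaling
open Summit.AtomisticToContinuum.HydrodynamicLimit.Theorems.KineticWindowGronwallFrame
open Summit.AtomisticToContinuum.HydrodynamicLimit.Theorems.KineticWindowGronwallNegative

namespace Summit.AtomisticToContinuum.HydrodynamicLimit.Theorems.TransferEntropyClockFrame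

variable {σ : ℝ} {N : ℕ}

/-- **The window exponential moment of a velocity observable** under the homogeneous local Gibbs law `G_N(a, u, θ)`:
`∫⁻ exp(β Σᵢ w⁻¹ ∫₀ʷ φ(vᵢ(r)) dr) dG_N(a, u, θ)`, `w = τ (N+1)^{-1/3}` (the left-hand side of every kinetic window-LD
node of the route for an x-independent functional). -/
def vMoment (σ a θ : ℝ) (u : V3) (N : ℕ) (Φ : TFlow σ N) (φ : V3 → ℝ) (β τ : ℝ) : ℝ≥0∞ :=
  ∫⁻ z, ENNReal.ofReal (Real.exp (β * ∑ i : Fin (N + 1),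
      (τ * ((N : ℝ) + 1) ^ (-(1 / 3 : ℝ)))⁻¹ *
        ∫ r in (0 : ℝ)..(τ * ((N : ℝ) + 1) ^ (-(1 / 3 : ℝ))), φ ((Φ.flow r z i).2)))
    ∂(localGibbsLaw σ (fun _ => a) (fun _ => u) (fun _ => θ) N Φ)

/-- A continuous velocity observable along a good orbit is interval integrable (velocities stay in the compact ball of
radius `√(2E(z))` by energy conservation; twin of `FastWindowRG.intervalIntegrable_orbit`). [folklore] -/
theorem intervalIntegrable_vel_orbit (Φ : TFlow σ N) {z : Config (N + 1) (Fin 3) T3} (hz : z ∈ Φ.good)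
    {φ : V3 → ℝ} (hφ : Continuous φ) (i : Fin (N + 1)) (a b : ℝ) :
    IntervalIntegrable (fun r => φ ((Φ.flow r z i).2)) volume a b := by
  have hγ : Measurable fun t => Φ.flow t z := (Φ.isTrajectory z hz).measurable_torus
  have hm : Measurable fun r => φ ((Φ.flow r z i).2) :=
    hφ.measurable.comp ((measurable_pi_apply i).comp hγ).snd
  set K : Set V3 := Metric.closedBall (0 : V3) (Real.sqrt (2 * configEnergy z))
  have hK : IsCompact K := isCompact_closedBall _ _
  have hmem : ∀ r, (Φ.flow r z i).2 ∈ K := by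
    intro r
    rw [Metric.mem_closedBall, dist_zero_right]
    refine Real.le_sqrt_of_sq_le ?_
    exact (norm_vel_sq_le_two_mul_configEnergy _ i).trans_eq (by rw [Φ.configEnergy_flow hz r])
  obtain ⟨B, hB⟩ := hK.exists_bound_of_continuousOn hφ.continuousOn
  exact (intervalIntegrable_const (c := B)).mono_fun' hm.aestronglyMeasurable
    (ae_of_all _ fun r => hB _ (hmem r))

/-- **Sum and window integral commute along good orbits**: `Σᵢ w⁻¹∫₀ʷ φ(vᵢ(r)) dr = w⁻¹ ∫₀ʷ Σᵢ φ(vᵢ(r)) dr`.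
[folklore] -/
theorem sum_window_eq_window_sum (Φ : TFlow σ N) {z : Config (N + 1) (Fin 3) T3} (hz : z ∈ Φ.good)
    {φ : V3 → ℝ} (hφ : Continuous φ) (β w : ℝ) :
    β * ∑ i : Fin (N + 1), w⁻¹ * ∫ r in (0 : ℝ)..w, φ ((Φ.flow r z i).2) =
      (β * w⁻¹) * ∫ r in (0 : ℝ)..w, ∑ i : Fin (N + 1), φ ((Φ.flow r z i).2) := by
  rw [intervalIntegral.integral_finsetSum fun i _ => intervalIntegrable_vel_orbit Φ hz hφ i 0 w, Finset.mul_sum,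
    Finset.mul_sum]
  refine Finset.sum_congr rfl fun i _ => ?_
  ring


/-! ## The window functional in "integral of the sum" shape and the canonical flow -/

/-- **Shape change (a.e.).** Under any law carried by the good set, the window moment equals the moment of
`exp((β w⁻¹) ∫₀ʷ Σᵢ φ(vᵢ(r)) dr)`. [folklore] -/
theorem vMoment_eq_lintegral_window (σ a θ : ℝ) (u : V3) (N : ℕ) (Φ : TFlow σ N) {φ : V3 → ℝ}
    (hφ : Continuous φ) (β τ : ℝ) :
    vMoment σ a θ u N Φ φ β τ =
      ∫⁻ z, ENNReal.ofReal (Real.exp ((β * (τ * ((N : ℝ) + 1) ^ (-(1 / 3 : ℝ)))⁻¹) *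
        ∫ r in (0 : ℝ)..(τ * ((N : ℝ) + 1) ^ (-(1 / 3 : ℝ))), ∑ i : Fin (N + 1), φ ((Φ.flow r z i).2)))
        ∂(localGibbsLaw σ (fun _ => a) (fun _ => u) (fun _ => θ) N Φ) := by
  unfold vMoment
  refine lintegral_congr_ae ?_
  have hgood : localGibbsLaw σ (fun _ => a) (fun _ => u) (fun _ => θ) N Φ Φ.goodᶜ = 0 :=
    (localGibbsLaw_absolutelyContinuous σ _ _ _ N Φ) Φ.measure_compl_good
  filter_upwards [(measure_eq_zero_iff_ae_notMem.1 hgood).mono fun z hz => by simpa using hz] with z hz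
  rw [sum_window_eq_window_sum Φ hz hφ]

/-- **Every flow may be replaced by the canonical flow** in the "integral of the sum" window moment under the
homogeneous law (`lintegral_window_congr_regFlow`; `0 < σ < 1/2`). [folklore] -/
theorem lintegral_window_eq_regFlow (hσ : 0 < σ) (hσh : σ < 2⁻¹) (a θ : ℝ) (u : V3) (N : ℕ) (Φ : TFlow σ N)
    (φ : V3 → ℝ) (c : ℝ) {w : ℝ} (hw : 0 ≤ w) :
    ∫⁻ z, ENNReal.ofReal (Real.exp (c * ∫ r in (0 : ℝ)..w, ∑ i : Fin (N + 1), φ ((Φ.flow r z i).2)))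
        ∂(localGibbsLaw σ (fun _ => a) (fun _ => u) (fun _ => θ) N Φ) =
      ∫⁻ z, ENNReal.ofReal (Real.exp (c * ∫ r in (0 : ℝ)..w, ∑ i : Fin (N + 1),
        φ ((Alexander.regFlow (Torus.geometry (Fin 3)) (hsDiameter σ N) r z i).2)))
        ∂(localGibbsLaw σ (fun _ => a) (fun _ => u) (fun _ => θ) N Φ) :=
  lintegral_window_congr_regFlow (hsDiameter_pos hσ N) (hsDiameter_lt_half hσ hσh N) Φ
    (localGibbsLaw_absolutelyContinuous σ _ _ _ N Φ) (fun y => ENNReal.ofReal (Real.exp (c * y)))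
    (fun y : Config (N + 1) (Fin 3) T3 => ∑ i : Fin (N + 1), φ ((y i).2)) hw

/-- The homogeneous law depends on the flow argument only through its type. [folklore] -/
theorem localGibbsLaw_flow_irrel (σ a θ : ℝ) (u : V3) (N : ℕ) (Φ Ψ : TFlow σ N) :
    localGibbsLaw σ (fun _ => a) (fun _ => u) (fun _ => θ) N Φ =
      localGibbsLaw σ (fun _ => a) (fun _ => u) (fun _ => θ) N Ψ := by
  rw [localGibbsLaw_eq, localGibbsLaw_eq]

/-- **Flow independence of the "integral of the sum" window moment** under the homogeneous law: any two flows give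
the same value (both agree with the canonical flow a.e. forward in time). [folklore] -/
theorem lintegral_window_flow_indep (hσ : 0 < σ) (hσh : σ < 2⁻¹) (a θ : ℝ) (u : V3) (N : ℕ) (Φ Ψ : TFlow σ N)
    (φ : V3 → ℝ) (c : ℝ) {w : ℝ} (hw : 0 ≤ w) :
    ∫⁻ z, ENNReal.ofReal (Real.exp (c * ∫ r in (0 : ℝ)..w, ∑ i : Fin (N + 1), φ ((Φ.flow r z i).2)))
        ∂(localGibbsLaw σ (fun _ => a) (fun _ => u) (fun _ => θ) N Φ) =
      ∫⁻ z, ENNReal.ofReal (Real.exp (c * ∫ r in (0 : ℝ)..w, ∑ i : Fin (N + 1), φ ((Ψ.flow r z i).2)))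
        ∂(localGibbsLaw σ (fun _ => a) (fun _ => u) (fun _ => θ) N Ψ) := by
  rw [lintegral_window_eq_regFlow hσ hσh a θ u N Φ φ c hw, lintegral_window_eq_regFlow hσ hσh a θ u N Ψ φ c hw,
    localGibbsLaw_flow_irrel σ a θ u N Φ Ψ]

/-! ## Removing the drift -/

/-- **Drift removal (exact for velocity observables).** `M(a, u, θ; φ(· − u); τ) = M(1, 0, θ; φ; τ)`: activity dummy,
canonical flow, velocity translation of the datum, Galilean boost of the canonical flow, and back to `Φ`. [folklore] -/
theorem vMoment_drift (hσ : 0 < σ) (hσh : σ < 2⁻¹) {a θ : ℝ} (ha : 0 < a) (hθ : 0 < θ) (u : V3) (N : ℕ)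
    (Φ : TFlow σ N) {φ : V3 → ℝ} (hφ : Continuous φ) (β : ℝ) {τ : ℝ} (hτ : 0 ≤ τ) :
    vMoment σ a θ u N Φ (fun v => φ (v - u)) β τ = vMoment σ 1 θ 0 N Φ φ β τ := by
  set hε := hsDiameter_pos hσ N
  set hε' := hsDiameter_lt_half hσ hσh N
  set w : ℝ := τ * ((N : ℝ) + 1) ^ (-(1 / 3 : ℝ)) with hwdef
  have hw : 0 ≤ w := mul_nonneg hτ (Real.rpow_nonneg (by positivity) _)
  set c : ℝ := β * w⁻¹ with hc
  set Ψ₀ : TFlow σ N := boostReg (d := Fin 3) hε hε' (N + 1) (-u) with hΨ₀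
  have hφu : Continuous fun v : V3 => φ (v - u) := hφ.comp (continuous_id.sub continuous_const)
  -- shape change on both sides
  rw [vMoment_eq_lintegral_window σ a θ u N Φ hφu β τ, vMoment_eq_lintegral_window σ 1 θ 0 N Φ hφ β τ]
  simp only [← hwdef, ← hc]
  -- activity dummy
  rw [localGibbsLaw_const_activity ha.ne' σ θ u N Φ]
  -- canonical flow under `G(1, u, θ)`
  rw [lintegral_window_eq_regFlow hσ hσh 1 θ u N Φ (fun v => φ (v - u)) c hw]
  -- velocity translation of the datum: `G(1, u, θ) = (velShift u)_# G(1, 0, θ)`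
  rw [lintegral_localGibbsLaw_velShift_zero σ 1 hθ u N Φ Φ]
  -- the canonical orbit of the translated datum is the boosted orbit of the boosted canonical flow
  have hint : ∀ z : Config (N + 1) (Fin 3) T3,
      (∫ r in (0 : ℝ)..w, ∑ i : Fin (N + 1),
        φ ((Alexander.regFlow (Torus.geometry (Fin 3)) (hsDiameter σ N) r (velShift u z) i).2 - u)) =
      ∫ r in (0 : ℝ)..w, ∑ i : Fin (N + 1), φ ((Ψ₀.flow r z i).2) := by
    intro z
    refine intervalIntegral.integral_congr fun r _ => ?_
    simp only [velShift_eq_boostAt_zero, regFlow_boostAt_zero hε hε', boostAt_apply, add_sub_cancel_right, hΨ₀]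
  simp_rw [hint]
  -- back to `Φ` under `G(1, 0, θ)`
  exact lintegral_window_flow_indep hσ hσh 1 θ 0 N Ψ₀ Φ φ c hw


/-! ## Removing the temperature -/

/-- **Thermal reduction.** `M(a, 0, θ; φ; τ) = M(a, 0, 1; φ(√θ ·); √θ τ)`: thermal scaling of velocities and time
(`lintegral_window_thermal` with the rescaled flow `thermalScale Φ (√θ)⁻¹`), then back to `Φ` by flow independence.
[folklore] -/
theorem vMoment_thermal (hσ : 0 < σ) (hσh : σ < 2⁻¹) (a : ℝ) {θ : ℝ} (hθ : 0 < θ) (N : ℕ) (Φ : TFlow σ N)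
    {φ : V3 → ℝ} (hφ : Continuous φ) (β : ℝ) {τ : ℝ} (hτ : 0 ≤ τ) :
    vMoment σ a θ 0 N Φ φ β τ = vMoment σ a 1 0 N Φ (fun v => φ (Real.sqrt θ • v)) β (Real.sqrt θ * τ) := by
  set sN : ℝ := ((N : ℝ) + 1) ^ (-(1 / 3 : ℝ)) with hsN
  have hsN0 : 0 < sN := Real.rpow_pos_of_pos (by positivity) _
  have hrt : 0 < Real.sqrt θ := Real.sqrt_pos.2 hθ
  set hc := inv_pos.2 hrt
  set Ψ : TFlow σ N := thermalScale Φ (Real.sqrt θ)⁻¹ hc with hΨdef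
  have hΨ : ∀ t z, Ψ.flow t z =
      scaleVel (Real.sqrt θ)⁻¹ (Φ.flow ((Real.sqrt θ)⁻¹ * t) (scaleVel (Real.sqrt θ)⁻¹⁻¹ z)) :=
    fun t z => thermalScale_flow Φ hc t z
  have hφθ : Continuous fun v : V3 => φ (Real.sqrt θ • v) := hφ.comp (continuous_const_smul (Real.sqrt θ))
  have hw : 0 ≤ τ * sN := mul_nonneg hτ hsN0.le
  have hw' : 0 ≤ Real.sqrt θ * τ * sN := mul_nonneg (mul_nonneg hrt.le hτ) hsN0.le
  -- both sides in the "integral of the sum" shape; the unit-frame side moved to the rescaled flow `Ψ`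
  rw [vMoment_eq_lintegral_window σ a θ 0 N Φ hφ β τ, vMoment_eq_lintegral_window σ a 1 0 N Φ hφθ β _]
  simp only [← hsN]
  rw [show Real.sqrt θ * τ * sN = Real.sqrt θ * τ * sN from rfl]
  rw [lintegral_window_flow_indep hσ hσh a 1 0 N Φ Ψ (fun v => φ (Real.sqrt θ • v))
    (β * (Real.sqrt θ * τ * sN)⁻¹) hw']
  -- the thermal dictionary
  rw [lintegral_window_thermal σ a hθ N Φ Ψ hΨ (fun y => ENNReal.ofReal (Real.exp ((β * (Real.sqrt θ * τ * sN)⁻¹) * y)))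
    (fun y : Config (N + 1) (Fin 3) T3 => ∑ i : Fin (N + 1), φ (Real.sqrt θ • (y i).2)) 0 (Real.sqrt θ * τ * sN)]
  refine lintegral_congr fun z => ?_
  have h1 : (Real.sqrt θ)⁻¹ * (Real.sqrt θ * τ * sN) = τ * sN := by
    field_simp
  have h2 : (Real.sqrt θ)⁻¹ * (0 : ℝ) = 0 := mul_zero _
  simp only [h1, h2, inv_inv, scaleVel_apply, smul_smul, mul_inv_cancel₀ hrt.ne', one_smul]
  congr 2
  have h3 : β * (Real.sqrt θ * τ * sN)⁻¹ * (Real.sqrt θ * ∫ r in (0 : ℝ)..(τ * sN),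
      ∑ i : Fin (N + 1), φ ((Φ.flow r z i).2)) =
      β * (τ * sN)⁻¹ * ∫ r in (0 : ℝ)..(τ * sN), ∑ i : Fin (N + 1), φ ((Φ.flow r z i).2) := by
    rw [mul_inv, mul_inv, ← mul_assoc]
    congr 1
    field_simp
  rw [h3]

/-- **FRAME REDUCTION of the window moment of a velocity observable.** For `0 < σ < 1/2`, `a, θ > 0`, a drift `u`, a
continuous `φ`, a tilt `β` and a window `τ ≥ 0`:
`M(a, u, θ; φ(· − u); τ) = M(1, 0, 1; φ(√θ ·); √θ τ)` for the same flow family. [folklore] -/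
theorem vMoment_frame (hσ : 0 < σ) (hσh : σ < 2⁻¹) {a θ : ℝ} (ha : 0 < a) (hθ : 0 < θ) (u : V3) (N : ℕ)
    (Φ : TFlow σ N) {φ : V3 → ℝ} (hφ : Continuous φ) (β : ℝ) {τ : ℝ} (hτ : 0 ≤ τ) :
    vMoment σ a θ u N Φ (fun v => φ (v - u)) β τ =
      vMoment σ 1 1 0 N Φ (fun v => φ (Real.sqrt θ • v)) β (Real.sqrt θ * τ) := by
  rw [vMoment_drift hσ hσh ha hθ u N Φ hφ β hτ, vMoment_thermal hσ hσh 1 hθ N Φ hφ β hτ]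


/-! ## An elementary exponential bound -/

/-- `(1 − 2δ)^{−3/2} ≤ e^{6δ}` for `0 ≤ δ ≤ 1/4`. [folklore] -/
theorem one_sub_two_mul_rpow_le_exp {δ : ℝ} (hδ0 : 0 ≤ δ) (hδ : δ ≤ 1 / 4) :
    (1 - 2 * δ) ^ (-(3 / 2 : ℝ)) ≤ Real.exp (6 * δ) := by
  have h1 : 0 < 1 - 2 * δ := by linarith
  have hinv : (1 - 2 * δ)⁻¹ ≤ Real.exp (4 * δ) := by
    rw [inv_le_iff_one_le_mul₀ h1]
    have h2 : 1 + 4 * δ ≤ Real.exp (4 * δ) := by linarith [Real.add_one_le_exp (4 * δ)]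
    nlinarith [Real.exp_pos (4 * δ)]
  calc (1 - 2 * δ) ^ (-(3 / 2 : ℝ)) = ((1 - 2 * δ)⁻¹) ^ ((3 / 2 : ℝ)) := by
        rw [Real.rpow_neg h1.le, Real.inv_rpow h1.le]
    _ ≤ (Real.exp (4 * δ)) ^ ((3 / 2 : ℝ)) :=
        Real.rpow_le_rpow (inv_nonneg.2 h1.le) hinv (by norm_num)
    _ = Real.exp (6 * δ) := by
        rw [← Real.exp_mul]
        ring_nf

/-! ## Static control with a velocity tail (for profiles that are close only on a compact set of velocities) -/

section Tail

/-- The Gaussian one-site exponential moment of the quadratic weight: `∫ e^{K(1+‖v‖²)} dN(0,1) ≤ e^{13K}` for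
`0 ≤ K ≤ 1/8`. [folklore] -/
theorem lintegral_exp_quadWeight_le {K : ℝ} (hK0 : 0 ≤ K) (hK : K ≤ 1 / 8) :
    ∫⁻ v, ENNReal.ofReal (Real.exp (K * (1 + ‖v‖ ^ 2))) ∂gaussMeasure (0 : V3) 1 ≤
      ENNReal.ofReal (Real.exp (13 * K)) := by
  have h2 : 2 * (2 * K) * (1 : ℝ) < 1 := by linarith
  have h := lintegral_exp_mul_norm_sq_gaussMeasure_le (E := V3) one_pos (by positivity : 0 ≤ 2 * K) h2 (0 : V3)
  simp only [norm_zero, ne_eq, OfNat.ofNat_ne_zero, not_false_eq_true, zero_pow, mul_zero, Real.exp_zero, one_mul,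
    mul_one, finrank_euclideanSpace_fin] at h
  have hpt : ∀ v : V3, ENNReal.ofReal (Real.exp (K * (1 + ‖v‖ ^ 2))) =
      ENNReal.ofReal (Real.exp K) * ENNReal.ofReal (Real.exp (2 * K * (‖v‖ ^ 2 / 2))) := by
    intro v
    rw [← ENNReal.ofReal_mul (Real.exp_nonneg _), ← Real.exp_add]
    ring_nf
  simp_rw [hpt]
  rw [lintegral_const_mul' _ _ ENNReal.ofReal_ne_top]
  refine (mul_le_mul' le_rfl h).trans ?_
  rw [← ENNReal.ofReal_mul (Real.exp_nonneg _)]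
  refine ENNReal.ofReal_le_ofReal ?_
  have hb : (1 - 2 * (2 * K)) ^ (-(3 : ℝ) / 2) ≤ Real.exp (6 * (2 * K)) := by
    have := one_sub_two_mul_rpow_le_exp (δ := 2 * K) (by positivity) (by linarith)
    rwa [show (-(3 : ℝ) / 2) = -(3 / 2 : ℝ) by norm_num]
  calc Real.exp K * (1 - 2 * (2 * K)) ^ (-(3 : ℝ) / 2) ≤ Real.exp K * Real.exp (6 * (2 * K)) := by
        gcongr
    _ = Real.exp (13 * K) := by rw [← Real.exp_add]; ring_nf

/-- **The Gaussian tail of the quadratic exponential weight is eventually small**: for `0 ≤ K ≤ 1/8` and `η > 0` there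
is a radius `L` with `∫_{‖v‖ > L} e^{K(1+‖v‖²)} dN(0,1) ≤ η` (absolute continuity of the integral + continuity of the
measure from above). [folklore] -/
theorem exists_tail_le {K : ℝ} (hK0 : 0 ≤ K) (hK : K ≤ 1 / 8) {η : ℝ} (hη : 0 < η) :
    ∃ L : ℝ, ∫⁻ v in {v : V3 | L < ‖v‖}, ENNReal.ofReal (Real.exp (K * (1 + ‖v‖ ^ 2))) ∂gaussMeasure (0 : V3) 1 ≤
      ENNReal.ofReal η := by
  set μ : Measure V3 := gaussMeasure (0 : V3) 1 with hμ
  have hfin : ∫⁻ v, ENNReal.ofReal (Real.exp (K * (1 + ‖v‖ ^ 2))) ∂μ ≠ ⊤ :=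
    ((lintegral_exp_quadWeight_le hK0 hK).trans_lt ENNReal.ofReal_lt_top).ne
  set s : ℕ → Set V3 := fun n => {v : V3 | (n : ℝ) < ‖v‖} with hs
  have hsm : ∀ n, NullMeasurableSet (s n) μ := fun n =>
    (isOpen_lt continuous_const continuous_norm).measurableSet.nullMeasurableSet
  have hanti : Antitone s := by
    intro m n hmn v hv
    have hv' : (n : ℝ) < ‖v‖ := hv
    have hmn' : (m : ℝ) ≤ n := by exact_mod_cast hmn
    exact lt_of_le_of_lt hmn' hv'
  haveI : IsProbabilityMeasure μ := by rw [hμ]; infer_instance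
  have hinter : ⋂ n, s n = ∅ := by
    ext v
    simp only [Set.mem_iInter, Set.mem_setOf_eq, Set.mem_empty_iff_false, iff_false, not_forall, not_lt, hs]
    exact ⟨⌈‖v‖⌉₊, Nat.le_ceil _⟩
  have hmeas : Filter.Tendsto (μ ∘ s) Filter.atTop (nhds 0) := by
    have h := tendsto_measure_iInter_atTop hsm hanti ⟨0, measure_ne_top μ _⟩
    rwa [hinter, measure_empty] at h
  have hint := tendsto_setLIntegral_zero hfin hmeas
  have hev := (ENNReal.tendsto_atTop_zero.1 hint) (ENNReal.ofReal η) (ENNReal.ofReal_pos.2 hη)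
  obtain ⟨n, hn⟩ := hev
  exact ⟨n, hn n le_rfl⟩

/-- `e^x + η ≤ e^{x + η}` for `x, η ≥ 0`. [folklore] -/
theorem exp_add_le_exp_add {x η : ℝ} (hx : 0 ≤ x) (hη : 0 ≤ η) : Real.exp x + η ≤ Real.exp (x + η) := by
  rw [Real.exp_add]
  have h1 : 1 ≤ Real.exp x := Real.one_le_exp hx
  have h2 : 1 + η ≤ Real.exp η := by linarith [Real.add_one_le_exp η]
  nlinarith [Real.exp_pos x, Real.exp_pos η]

/-- **STATIC PERTURBATION BOUND WITH A TAIL.** Under `G_N(a, 0, 1)` (`a > 0`, `σ ≤ 1/2`), a continuous velocity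
observable `H` with `|H(v)| ≤ δ (1 + ‖v‖²)` for `‖v‖ ≤ L` and `|H(v)| ≤ K (1 + ‖v‖²)` everywhere
(`0 ≤ δ ≤ 1/8`) has window exponential moment `≤ e^{(13δ + η)(N+1)}` at tilt `1` at every window, where
`η` bounds the Gaussian tail `∫_{‖v‖ > L} e^{K(1+‖v‖²)} dN(0,1)` (Jensen in time + invariance, one-site factorisation
`lintegral_exp_sum_localGibbsMeasure_const_le`). [folklore] -/
theorem vMoment_le_of_abs_le_tail (σ : ℝ) {a : ℝ} (ha : 0 < a) (hσ2 : σ ≤ 1 / 2) (N : ℕ) (Φ : TFlow σ N)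
    {H : V3 → ℝ} (hH : Continuous H) {δ K L η : ℝ} (hδ0 : 0 ≤ δ) (hδ : δ ≤ 1 / 8)
    (hη : 0 ≤ η) (hHδ : ∀ v : V3, ‖v‖ ≤ L → |H v| ≤ δ * (1 + ‖v‖ ^ 2)) (hHK : ∀ v : V3, |H v| ≤ K * (1 + ‖v‖ ^ 2))
    (hT : ∫⁻ v in {v : V3 | L < ‖v‖}, ENNReal.ofReal (Real.exp (K * (1 + ‖v‖ ^ 2))) ∂gaussMeasure (0 : V3) 1 ≤
      ENNReal.ofReal η)
    {τ : ℝ} (hτ : 0 < τ) :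
    vMoment σ a 1 0 N Φ H 1 τ ≤ ENNReal.ofReal (Real.exp ((13 * δ + η) * ((N : ℝ) + 1))) := by
  have hw : 0 < τ * ((N : ℝ) + 1) ^ (-(1 / 3 : ℝ)) := mul_pos hτ (Real.rpow_pos_of_pos (by positivity) _)
  have hF : Continuous fun y : T3 × V3 => H y.2 := hH.comp continuous_snd
  unfold vMoment
  refine (lintegral_exp_windowSum_le_static σ a 1 0 N Φ hF 1 hw).trans ?_
  -- one-site bound
  have hone : ∀ x : T3, ∫⁻ v, ENNReal.ofReal (Real.exp ((fun y : T3 × V3 => 1 * H y.2) (x, v)))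
      ∂gaussMeasure (0 : V3) 1 ≤ ENNReal.ofReal (Real.exp (13 * δ + η)) := by
    intro x
    have hsm : MeasurableSet {v : V3 | L < ‖v‖} := (isOpen_lt continuous_const continuous_norm).measurableSet
    have hpt : ∀ v : V3, ENNReal.ofReal (Real.exp ((fun y : T3 × V3 => 1 * H y.2) (x, v))) ≤
        ENNReal.ofReal (Real.exp (δ * (1 + ‖v‖ ^ 2))) +
          Set.indicator {v : V3 | L < ‖v‖} (fun v => ENNReal.ofReal (Real.exp (K * (1 + ‖v‖ ^ 2)))) v := by
      intro v
      simp only [one_mul]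
      by_cases hv : ‖v‖ ≤ L
      · refine le_add_right (ENNReal.ofReal_le_ofReal (Real.exp_le_exp.2 ((le_abs_self _).trans (hHδ v hv))))
      · rw [Set.indicator_of_mem (show v ∈ {v : V3 | L < ‖v‖} from lt_of_not_ge hv)]
        exact le_add_left (ENNReal.ofReal_le_ofReal (Real.exp_le_exp.2 ((le_abs_self _).trans (hHK v))))
    refine (lintegral_mono hpt).trans ?_
    rw [lintegral_add_left (by fun_prop), lintegral_indicator hsm]
    refine (add_le_add (lintegral_exp_quadWeight_le hδ0 hδ) hT).trans ?_
    rw [← ENNReal.ofReal_add (Real.exp_nonneg _) hη]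
    exact ENNReal.ofReal_le_ofReal (exp_add_le_exp_add (by positivity) hη)
  -- assemble
  have hq : Measurable fun y : T3 × V3 => 1 * H y.2 := (hH.measurable.comp measurable_snd).const_mul 1
  have hst := lintegral_exp_sum_localGibbsMeasure_const_le ha one_pos (0 : V3) hσ2 N hq hone
  rw [localGibbsLaw_eq]
  have hsum : ∀ z : Config (N + 1) (Fin 3) T3, (1 : ℝ) * ∑ i, H (z i).2 = ∑ i, 1 * H (z i).2 := by
    intro z; rw [Finset.mul_sum]
  simp_rw [hsum]
  refine hst.trans ?_
  rw [← ENNReal.ofReal_pow (Real.exp_nonneg _), ← Real.exp_nat_mul]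
  push_cast
  ring_nf
  exact le_rfl

end Tail


end Summit.AtomisticToContinuum.HydrodynamicLimit.Theorems.TransferEntropyClockFrame

end
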